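import Summits.PneNP.PneNP.Theses.SymmetryBudget
import Literature.Computability.Complexity.SymmetricCircuit

/-!
# `HamCompiles` is refutation-immune; modulo `WindowHam` it is the summit (negative lemmas)

Crux `stmt-PneNP-10637` of route `PneNP/SymmetryBudget` reads, definitionally
(`hamCompiles_iff`, `Iff.rfl` over `Literature/Computability/Complexity/SymmetricCircuit.lean`):
`NP Bool ⊆ P Bool → ∃ p ∀ m, HasSymCircuit tcBasis (pointStabiliserBudget m ⌊log₂ m⌋) (p m) HAM_m`.

Negative knowledge recorded here (cdisprove seat `refuter-cdisprove-stmt-PneNP-10637-0`, extending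
the crux-attack of `refuter-rattack-stmt-PneNP-10637-0`):

* `np_subset_p_of_not_hamCompiles`, `not_pneNP_of_not_hamCompiles`: ANY refutation of the crux is a
  proof of `NP ⊆ P` over `{0,1}` (Cook's classes), i.e. of `¬PneNP`. No unconditional kill exists.
* `not_hamCompiles_iff`: a refutation is exactly `NP ⊆ P` plus the failure of the compilation.
* `hamCompilesWithoutHyp_false_of_windowHam` (load-bearing analysis): the conclusion with the
  hypothesis dropped is denied by the sibling crux `WindowHam`; so
* `hamCompiles_false_of_windowHam_of_np_subset_p`: modulo `WindowHam`, `¬HamCompiles ↔ NP ⊆ P`,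
  i.e. GIVEN crux #2 this crux is literally the summit `PneNP` (the converse `PneNP → HamCompiles`
  is one line and is not landed here, being a positive statement of a route item).
-/

-- `Summit.PneNP.PneNP.…` duplicates `PneNP` BY DESIGN (single-problem summit, D-0017); the Summits
-- library sets this option globally (lakefile), repeated here so a standalone `lean check` is warning-free.
set_option linter.dupNamespace false

namespace Summit.PneNP.PneNP.Theorems.HamCompiles.Negative

open Literature.Computability.Complexity
open Summit.PneNP.PneNP.Theses.SymmetryBudget (HamCompiles WindowHam)
open scoped Classical

/-- The crux, unfolded over the named vocabulary of `SymmetricCircuit.lean` (definitional). -/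
theorem hamCompiles_iff :
    HamCompiles ↔ (PNPWave0.NP Bool ⊆ PNPWave0.P Bool →
      ∃ p : Polynomial ℕ, ∀ m : ℕ,
        HasSymCircuit tcBasis (pointStabiliserBudget m (Nat.log 2 m)) (p.eval m)
          (fun x : Fin m × Fin m → Bool =>
            decide (SimpleGraph.fromRel fun u v => x (u, v) = true :
              SimpleGraph (Fin m)).IsHamiltonian)) :=
  Iff.rfl

/-- Crux #2 `WindowHam`, unfolded over the same vocabulary (definitional). -/
theorem windowHam_iff :
    WindowHam ↔ ∀ p : Polynomial ℕ, ∃ᶠ m in Filter.atTop,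
      ¬ HasSymCircuit tcBasis (pointStabiliserBudget m (Nat.log 2 m)) (p.eval m)
          (fun x : Fin m × Fin m → Bool =>
            decide (SimpleGraph.fromRel fun u v => x (u, v) = true :
              SimpleGraph (Fin m)).IsHamiltonian) :=
  Iff.rfl

/-- The summit is the negation of the crux's hypothesis (`Set.not_subset`). -/
theorem pneNP_iff_not_np_subset_p : PneNP ↔ ¬ (PNPWave0.NP Bool ⊆ PNPWave0.P Bool) :=
  (Set.not_subset (s := PNPWave0.NP Bool) (t := PNPWave0.P Bool)).symm

/-- **Refutation-immunity.** Any refutation of `HamCompiles` proves `NP ⊆ P` over `{0,1}`. -/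
theorem np_subset_p_of_not_hamCompiles (h : ¬ HamCompiles) :
    PNPWave0.NP Bool ⊆ PNPWave0.P Bool := by
  by_contra hn
  exact h (hamCompiles_iff.2 fun hsub => absurd hsub hn)

/-- … equivalently, any refutation of `HamCompiles` refutes the summit. -/
theorem not_pneNP_of_not_hamCompiles (h : ¬ HamCompiles) : ¬ PneNP :=
  fun hP => pneNP_iff_not_np_subset_p.1 hP (np_subset_p_of_not_hamCompiles h)

/-- The exact content of a refutation: `NP ⊆ P` together with the failure of the compilation
(no polynomial bounds Bud(m,⌊log₂ m⌋)-symmetric threshold circuits for HAM at every `m`). -/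
theorem not_hamCompiles_iff :
    ¬ HamCompiles ↔ PNPWave0.NP Bool ⊆ PNPWave0.P Bool ∧
      ¬ ∃ p : Polynomial ℕ, ∀ m : ℕ,
        HasSymCircuit tcBasis (pointStabiliserBudget m (Nat.log 2 m)) (p.eval m)
          (fun x : Fin m × Fin m → Bool =>
            decide (SimpleGraph.fromRel fun u v => x (u, v) = true :
              SimpleGraph (Fin m)).IsHamiltonian) := by
  rw [hamCompiles_iff]; exact Classical.not_imp

/-- **Load-bearing analysis.** The conclusion of the crux with its hypothesis `NP ⊆ P` dropped
is refuted by the sibling crux `WindowHam` (so any proof must use the hypothesis, unless crux #2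
is false). -/
theorem hamCompilesWithoutHyp_false_of_windowHam (hW : WindowHam) :
    ¬ ∃ p : Polynomial ℕ, ∀ m : ℕ,
        HasSymCircuit tcBasis (pointStabiliserBudget m (Nat.log 2 m)) (p.eval m)
          (fun x : Fin m × Fin m → Bool =>
            decide (SimpleGraph.fromRel fun u v => x (u, v) = true :
              SimpleGraph (Fin m)).IsHamiltonian) := by
  rintro ⟨p, hp⟩
  obtain ⟨m, hm⟩ := ((windowHam_iff.1 hW) p).exists
  exact hm (hp m)

/-- **Modulo crux #2 the crux is the summit**: given `WindowHam`, `HamCompiles` fails as soon as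
`NP ⊆ P` — i.e. `WindowHam → (¬HamCompiles ↔ NP ⊆ P)`, the converse being
`np_subset_p_of_not_hamCompiles`. -/
theorem hamCompiles_false_of_windowHam_of_np_subset_p (hW : WindowHam)
    (hsub : PNPWave0.NP Bool ⊆ PNPWave0.P Bool) : ¬ HamCompiles :=
  fun h => hamCompilesWithoutHyp_false_of_windowHam hW (hamCompiles_iff.1 h hsub)

/-- The two-sided form: given `WindowHam`, refuting `HamCompiles` is exactly proving `NP ⊆ P`. -/
theorem not_hamCompiles_iff_of_windowHam (hW : WindowHam) :
    ¬ HamCompiles ↔ PNPWave0.NP Bool ⊆ PNPWave0.P Bool :=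
  ⟨np_subset_p_of_not_hamCompiles, hamCompiles_false_of_windowHam_of_np_subset_p hW⟩

end Summit.PneNP.PneNP.Theorems.HamCompiles.Negative
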